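import Summits.AtomisticToContinuum.Crystallization.Theorems.ContactSaturationLadderCompetitorGradeShells

/-!
# Route `ContactSaturationLadder`, item `LooseTextureRung` (stmt-AtomisticToContinuum-30303): the competitor grade `γ = 5/7` — part 3: the dilated trial energy and the grade

Continuation of `ContactSaturationLadderCompetitorGrade` (lens-1 g36 file `ContactSaturationLadderCompetitorGrade.lean`, sha256 1895364dc235fe8e…,
split at landing by hand-2 g10 under the gate's ≤ 400-line rule; same namespace, declarations byte-identical).
-/

noncomputable section

open scoped BigOperators Topology
open Filter Set Metric

namespace Summit.AtomisticToContinuum.Crystallization.Theorems.ContactSaturationLadderCompetitorGrade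

open Literature.MathematicalPhysics.StatisticalMechanics
open Summit.AtomisticToContinuum.Crystallization.Theorems.MieRungEnergetic

/-- **The dilated fcc trial energy**: the Lennard-Jones energy per particle of the fcc lattice at
nearest-neighbour distance `√(19/20)` is at most `−5/7` — the `1288` sites of the first 36
shells contribute `-1.4291005/2`, every other site contributes `≤ 0`. [folklore] -/
theorem energyPerParticle_fccDilated_le :
    (fccPeriodicConfiguration (a := Real.sqrt (19 / 20)) (h := Real.sqrt (19 / 30)) sqrt_a_ne_zero
        sqrt_h_ne_zero).energyPerParticle (miePotential 6) ≤ -(5 / 7 : ℝ) := by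
  classical
  set P := fccPeriodicConfiguration (a := Real.sqrt (19 / 20)) (h := Real.sqrt (19 / 30))
    sqrt_a_ne_zero sqrt_h_ne_zero with hP
  set a : ℝ := Real.sqrt (19 / 20) with ha_def
  set h : ℝ := Real.sqrt (19 / 30) with hh_def
  have ha : 0 < a := Real.sqrt_pos.2 (by norm_num)
  have ha2 : a ^ 2 = 19 / 20 := Real.sq_sqrt (by norm_num)
  have hh : h ^ 2 = 2 / 3 * a ^ 2 := sqrt_h_sq
  have hq0 : (6 : ℕ) ≠ 0 := by norm_num
  set x₀ : EuclideanSpace ℝ (Fin 3) := barlowPos a h constHagg ((0 : ℕ) : ℤ) 0 0 with hx₀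
  have hx₀mem : x₀ ∈ barlowStacking a h constHagg := barlowPos_mem _ _ _
  have hpts : ∀ z : EuclideanSpace ℝ (Fin 3), z ∈ P.points ↔ z ∈ barlowStacking a h constHagg :=
    fun z => by rw [fccDilated_points]
  -- the sites as points, and the retained finset of the lattice sum's index type
  set pt : ℤ × ℤ × ℤ → EuclideanSpace ℝ (Fin 3) :=
    fun t => barlowPos a h constHagg t.1 t.2.1 t.2.2 with hpt
  have hpt_ne : ∀ t ∈ fccShells, pt t ≠ x₀ := by
    intro t ht
    have ht0 : (t.1, t.2.1, t.2.2) ≠ (((0 : ℕ) : ℤ), (0 : ℤ), (0 : ℤ)) := by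
      intro h0
      apply zero_not_mem_fccShells
      simp only [Prod.mk.injEq, Nat.cast_zero] at h0
      obtain ⟨h1, h2, h3⟩ := h0
      have : t = ((0 : ℤ), (0 : ℤ), (0 : ℤ)) := Prod.ext h1 (Prod.ext h2 h3)
      rwa [this] at ht
    exact barlowPos_ne_of_ne ha hh ht0
  have hpt_inj : ∀ t ∈ fccShells.toFinset, ∀ t' ∈ fccShells.toFinset, pt t = pt t' → t = t' := by
    intro t _ t' _ heq
    by_contra hne
    have hne' : (t.1, t.2.1, t.2.2) ≠ (t'.1, t'.2.1, t'.2.2) := by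
      intro h0
      simp only [Prod.mk.injEq] at h0
      exact hne (Prod.ext h0.1 (Prod.ext h0.2.1 h0.2.2))
    exact barlowPos_ne_of_ne ha hh hne' heq
  set S := {y : EuclideanSpace ℝ (Fin 3) // y ∈ P.points ∧ y ≠ x₀} with hS
  set F : EuclideanSpace ℝ (Fin 3) → ℝ := fun y => miePotential 6 (dist x₀ y) with hF
  set f : S → ℝ := fun y => F y.1 with hf
  set TF : Finset (EuclideanSpace ℝ (Fin 3)) := fccShells.toFinset.image pt with hTF
  have hTFmem : ∀ y ∈ TF, y ∈ P.points ∧ y ≠ x₀ := by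
    intro y hy
    rw [hTF, Finset.mem_image] at hy
    obtain ⟨t, ht, rfl⟩ := hy
    exact ⟨(hpts _).2 (barlowPos_mem _ _ _), hpt_ne t (List.mem_toFinset.1 ht)⟩
  set s₀ : Finset S := TF.subtype fun y => y ∈ P.points ∧ y ≠ x₀ with hs₀
  -- summability and sign
  have hsum : Summable f :=
    summable_dist (V := miePotential 6) (A := 1 / 6)
      (fun r hr => LadderGroundStates.miePotential_nonpos hq0 hr)
      (fun r hr => neg_six_le_miePotential le_rfl hr) (by norm_num) P x₀
  have hsign : ∀ y ∉ s₀, 0 ≤ (fun b => -f b) y := by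
    intro y _
    have hyS : y.1 ∈ barlowStacking a h constHagg := (hpts _).1 y.2.1
    have hya : a ≤ dist x₀ y.1 :=
      le_dist_of_mem_barlowStacking_ideal isHaggSeq_const ha hh hx₀mem hyS (Ne.symm y.2.2)
    have hd0 : 0 < dist x₀ y.1 := lt_of_lt_of_le ha hya
    have hd2 : 19 / 20 ≤ dist x₀ y.1 ^ 2 := by
      rw [← ha2]; exact pow_le_pow_left₀ ha.le hya 2
    simp only [hf, hF, neg_nonneg]
    exact miePotential_six_nonpos_of_sq_ge hd0 hd2
  have h1 := sum_le_hasSum s₀ hsign hsum.hasSum.neg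
  rw [Finset.sum_neg_distrib] at h1
  have htsum : (∑' y : S, f y) ≤ ∑ y ∈ s₀, f y := by linarith
  -- the retained sum, site by site
  set g : ℤ → ℝ := fun n => 1 / 12 * ((19 / 20 : ℝ) * n)⁻¹ ^ 6 - 1 / 6 * ((19 / 20 : ℝ) * n)⁻¹ ^ 3
    with hg
  have hFpt : ∀ t ∈ fccShells, F (pt t) = g (fccGram t) := by
    intro t _
    simp only [hF, hg]
    refine miePotential_six_eq_of_sq ?_
    rw [← ha2]
    exact dist_sq_eq_fccGram hh t.1 t.2.1 t.2.2
  have hs₀sum : ∑ y ∈ s₀, f y = (fccShells.map fun t => g (fccGram t)).sum := by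
    rw [hs₀, Finset.sum_subtype_eq_sum_filter (f := F), Finset.filter_true_of_mem hTFmem, hTF,
      Finset.sum_image hpt_inj, List.sum_toFinset _ fccShells_nodup]
    exact congrArg List.sum (List.map_congr_left hFpt)
  have hlist : (fccShells.map fun t => g (fccGram t)).sum =
      ((List.replicate 12 (1 : ℤ) ++
    List.replicate 6 (2 : ℤ) ++
    List.replicate 24 (3 : ℤ) ++
    List.replicate 12 (4 : ℤ) ++
    List.replicate 24 (5 : ℤ) ++
    List.replicate 8 (6 : ℤ) ++
    List.replicate 48 (7 : ℤ) ++
    List.replicate 6 (8 : ℤ) ++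
    List.replicate 36 (9 : ℤ) ++
    List.replicate 24 (10 : ℤ) ++
    List.replicate 24 (11 : ℤ) ++
    List.replicate 24 (12 : ℤ) ++
    List.replicate 72 (13 : ℤ) ++
    List.replicate 48 (15 : ℤ) ++
    List.replicate 12 (16 : ℤ) ++
    List.replicate 48 (17 : ℤ) ++
    List.replicate 30 (18 : ℤ) ++
    List.replicate 72 (19 : ℤ) ++
    List.replicate 24 (20 : ℤ) ++
    List.replicate 48 (21 : ℤ) ++
    List.replicate 24 (22 : ℤ) ++
    List.replicate 48 (23 : ℤ) ++
    List.replicate 8 (24 : ℤ) ++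
    List.replicate 84 (25 : ℤ) ++
    List.replicate 24 (26 : ℤ) ++
    List.replicate 96 (27 : ℤ) ++
    List.replicate 48 (28 : ℤ) ++
    List.replicate 24 (29 : ℤ) ++
    List.replicate 96 (31 : ℤ) ++
    List.replicate 6 (32 : ℤ) ++
    List.replicate 96 (33 : ℤ) ++
    List.replicate 48 (34 : ℤ) ++
    List.replicate 48 (35 : ℤ) ++
    List.replicate 36 (36 : ℤ)).map g).sum := by
    rw [← map_fccGram_fccShells, List.map_map]
    rfl
  have hval : ((List.replicate 12 (1 : ℤ) ++
    List.replicate 6 (2 : ℤ) ++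
    List.replicate 24 (3 : ℤ) ++
    List.replicate 12 (4 : ℤ) ++
    List.replicate 24 (5 : ℤ) ++
    List.replicate 8 (6 : ℤ) ++
    List.replicate 48 (7 : ℤ) ++
    List.replicate 6 (8 : ℤ) ++
    List.replicate 36 (9 : ℤ) ++
    List.replicate 24 (10 : ℤ) ++
    List.replicate 24 (11 : ℤ) ++
    List.replicate 24 (12 : ℤ) ++
    List.replicate 72 (13 : ℤ) ++
    List.replicate 48 (15 : ℤ) ++
    List.replicate 12 (16 : ℤ) ++
    List.replicate 48 (17 : ℤ) ++
    List.replicate 30 (18 : ℤ) ++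
    List.replicate 72 (19 : ℤ) ++
    List.replicate 24 (20 : ℤ) ++
    List.replicate 48 (21 : ℤ) ++
    List.replicate 24 (22 : ℤ) ++
    List.replicate 48 (23 : ℤ) ++
    List.replicate 8 (24 : ℤ) ++
    List.replicate 84 (25 : ℤ) ++
    List.replicate 24 (26 : ℤ) ++
    List.replicate 96 (27 : ℤ) ++
    List.replicate 48 (28 : ℤ) ++
    List.replicate 24 (29 : ℤ) ++
    List.replicate 96 (31 : ℤ) ++
    List.replicate 6 (32 : ℤ) ++
    List.replicate 96 (33 : ℤ) ++
    List.replicate 48 (34 : ℤ) ++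
    List.replicate 48 (35 : ℤ) ++
    List.replicate 36 (36 : ℤ)).map g).sum ≤ -(2 * (5 / 7 : ℝ)) := by
    simp only [List.map_append, List.map_replicate, List.sum_append, List.sum_replicate,
      nsmul_eq_mul, hg]
    push_cast
    norm_num
  -- assemble
  unfold PeriodicConfiguration.energyPerParticle
  rw [fccDilated_motif, Finset.card_singleton, Finset.sum_singleton]
  have key : (∑' y : S, f y) ≤ -(2 * (5 / 7 : ℝ)) := by
    rw [hs₀sum, hlist] at htsum
    exact htsum.trans hval
  have hcast : ((1 : ℕ) : ℝ) = 1 := by norm_num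
  rw [hcast]
  calc (2 * (1 : ℝ))⁻¹ * ∑' y : S, f y ≤ (2 * (1 : ℝ))⁻¹ * (-(2 * (5 / 7 : ℝ))) :=
        mul_le_mul_of_nonneg_left key (by norm_num)
    _ = -(5 / 7 : ℝ) := by ring

/-! ### The competitor grade `γ = 5/7` -/

/-- **`E_LJ(N)/N ≤ −5/7 + ε` eventually** (`ε > 0`): the dilated fcc lattice is a periodic trial
state with energy per particle `≤ −5/7`, and `E_V(N)/N` is eventually below every periodic
energy per particle plus `ε` (`MieRungEnergetic.eventually_groundStateEnergy_div_le` for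
`V = miePotential 6 = lennardJones`, decay constant `A = 1/6`, stability constant `C = 31250/6`).
[folklore] -/
theorem eventually_groundStateEnergy_lennardJones_div_le {ε : ℝ} (hε : 0 < ε) :
    ∀ᶠ N : ℕ in atTop, groundStateEnergy lennardJones 3 N / N ≤ -(5 / 7 : ℝ) + ε := by
  have hq : 6 ≤ 6 := le_rfl
  have hq0 : (6 : ℕ) ≠ 0 := by norm_num
  have h := eventually_groundStateEnergy_div_le (V := miePotential 6) (A := 1 / 6)
    (C := 31250 / ((6 : ℕ) : ℝ)) (LadderGroundStates.miePotential_zero 6)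
    (fun r hr => LadderGroundStates.miePotential_nonpos hq0 hr)
    (fun r hr => neg_six_le_miePotential hq hr) (by norm_num) (le_interactionEnergy_miePotential hq)
    (fccPeriodicConfiguration (a := Real.sqrt (19 / 20)) (h := Real.sqrt (19 / 30)) sqrt_a_ne_zero
      sqrt_h_ne_zero)
    hε
  rw [miePotential_six] at h
  filter_upwards [h] with N hN
  have hfcc := energyPerParticle_fccDilated_le
  rw [miePotential_six] at hfcc
  exact hN.trans (by linarith)

/-- **The competitor grade `γ = 5/7`** (`Competitor (5/7)` of the SPARSE ladder, unfolded):
for every `ε > 0` there is `n₀` with `E_LJ(n) ≤ (−5/7 + ε)·n` for all `n ≥ n₀`. [folklore] -/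
theorem competitor_grade :
    ∀ ε : ℝ, 0 < ε → ∃ n₀ : ℕ, ∀ n : ℕ, n₀ ≤ n →
      groundStateEnergy lennardJones 3 n ≤ (-(5 / 7 : ℝ) + ε) * n := by
  intro ε hε
  obtain ⟨n₀, hn₀⟩ := Filter.eventually_atTop.mp (eventually_groundStateEnergy_lennardJones_div_le hε)
  refine ⟨max n₀ 1, fun n hn => ?_⟩
  have hn1 : 1 ≤ n := le_trans (le_max_right _ _) hn
  have hn0 : (0 : ℝ) < n := by exact_mod_cast hn1
  have h' := hn₀ n (le_trans (le_max_left _ _) hn)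
  rwa [div_le_iff₀ hn0] at h'

end Summit.AtomisticToContinuum.Crystallization.Theorems.ContactSaturationLadderCompetitorGrade

end
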